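import Literature.Topology.FourManifolds.CuspSplittingPoint
import Literature.Topology.FourManifolds.CuspModelJets
import Literature.Topology.FourManifolds.TwoGenericMapsExist
import HarnessLib

/-!
# Whitney's data at a simple cusp of a generic map `ℝ⁴ → ℝ²`

Topic `Literature/Topology/FourManifolds` (programme of the fact
`Literature.Topology.FourManifolds.exists_isSimplifiedBrokenLefschetzFibration`, Baykur–Saeki 2017, §2.1:
the cusps of a generic map `X⁴ → Σ²` are modelled on `(t, x, y, z) ↦ (t, x³ + tx ± y² ± z²)`).
This file closes the cusp-splitting line: at a point `p` of a `C^∞` map `F : ℝ⁴ → ℝ²` with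
`dF_p ≠ 0` which is a cusp candidate, 1-jet-transverse and cusp-generic (the three pointwise
conditions that `TwoGenericMapsExist.exists_twoGeneric_map` guarantees generically), there are
centred smooth charts in which `F = (t, h(t, x) + ε₂ y² + ε₃ z²)` with a planar germ `h`
satisfying EXACTLY the hypotheses of Whitney's cusp theorem in Golubitsky–Guillemin's form
(VI §2, proof of Thm. 2.4): `h(0) = 0`, `∂ₜh(0) = ∂ₓh(0) = 0`, `∂ₓ²h(0) = 0`, `∂ₓ³h(0) ≠ 0`,
`∂ₜ∂ₓh(0) ≠ 0` (`HasWhitneyCuspData F p`, `hasWhitneyCuspData_of_simpleCusp`).  Whitney's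
planar normal form `(x₁, x₁x₂ + x₂³)` (GG VI Thm. 2.4, via the Malgrange preparation theorem)
then yields the cusp chart; that theorem is not formalised in the tree.

* `HasWhitneyCuspData F p` — the chart data with Whitney's conditions (local in the germ:
  `HasWhitneyCuspData.congr_of_eventuallyEq`);
* `hasWhitneyCuspData_of_simpleCusp` — from `hasCuspSplitChart_of_isCuspCandidateAt`, a linear
  shear of the target killing `∂ₜh(0)`, transport of the three conditions to the split model and
  `whitney_conditions_of_cuspModel`.

Everything is proved; `HasWhitneyCuspData` and `targetShear` are the only definitions; no named
fact (D-0026).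

## References

* M. Golubitsky, V. Guillemin, *Stable Mappings and Their Singularities*, GTM 14 (1973), Ch. VI
  §2, (†) p. 147, Def. 2.3, Thm. 2.4 and its proof. [GolubitskyGuillemin1973]
* H. Whitney, *On singularities of mappings of Euclidean spaces. I*, Ann. of Math. 62 (1955),
  374–410. [Whitney1955]
* R. İ. Baykur, O. Saeki, *Simplifying indefinite fibrations on 4-manifolds*, arXiv:1705.11169,
  §2.1, p. 6. [BaykurSaeki2017]
-/

noncomputable section

set_option maxSynthPendingDepth 2

open Set Function Filter Module
open scoped ContDiff Topology

namespace Literature.Topology.FourManifolds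

/-- Local notation: `𝔼 n` is the model Euclidean space `EuclideanSpace ℝ (Fin n)`. -/
local notation "𝔼 " n:arg => EuclideanSpace ℝ (Fin n)

/-- Local notation: the coordinate covectors of `ℝ²`. -/
local notation "π₂" => (EuclideanSpace.proj (𝕜 := ℝ) (ι := Fin 2))

/-- **Whitney's data at a cusp** of `F : ℝ⁴ → ℝ²` at `p`: a cusp-splitting chart
(`HasCuspSplitChart`) whose planar germ `h` satisfies `h(0) = 0`, `∂ₜh(0) = 0`, `∂ₓh(0) = 0`,
`∂ₓ²h(0) = 0`, `∂ₓ³h(0) ≠ 0`, `∂ₜ∂ₓh(0) ≠ 0` — the hypotheses of Whitney's cusp theorem in the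
coordinates `(†)` of Golubitsky–Guillemin VI §2 (proof of Thm. 2.4).
[cite: GolubitskyGuillemin1973, Ch. VI §2, proof of Thm. 2.4] -/
def HasWhitneyCuspData (F : 𝔼 4 → 𝔼 2) (p : 𝔼 4) : Prop :=
  ∃ (φ : OpenPartialHomeomorph (𝔼 4) (𝔼 4)) (ψ : OpenPartialHomeomorph (𝔼 2) (𝔼 2))
    (h : ℝ × ℝ → ℝ) (U : Set (ℝ × ℝ)) (ε₂ ε₃ : ℝ),
    p ∈ φ.source ∧ φ p = 0 ∧ MapsTo F φ.source ψ.source ∧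
    ContDiffOn ℝ ∞ φ φ.source ∧ ContDiffOn ℝ ∞ φ.symm φ.target ∧
    ContDiffOn ℝ ∞ ψ ψ.source ∧ ContDiffOn ℝ ∞ ψ.symm ψ.target ∧
    IsOpen U ∧ ContDiffOn ℝ ∞ h U ∧ (∀ q ∈ φ.source, ((φ q) 0, (φ q) 1) ∈ U) ∧
    ε₂ ^ 2 = 1 ∧ ε₃ ^ 2 = 1 ∧
    (∀ q ∈ φ.source, ψ (F q) 0 = φ q 0 ∧
      ψ (F q) 1 = h ((φ q) 0, (φ q) 1) + ε₂ * (φ q) 2 ^ 2 + ε₃ * (φ q) 3 ^ 2) ∧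
    h 0 = 0 ∧ fderiv ℝ h 0 ((1 : ℝ), (0 : ℝ)) = 0 ∧ fderiv ℝ h 0 ((0 : ℝ), (1 : ℝ)) = 0 ∧
    fderiv ℝ (fderiv ℝ h) 0 ((0 : ℝ), (1 : ℝ)) ((0 : ℝ), (1 : ℝ)) = 0 ∧
    fderiv ℝ (fderiv ℝ (fderiv ℝ h)) 0 ((0 : ℝ), (1 : ℝ)) ((0 : ℝ), (1 : ℝ)) ((0 : ℝ), (1 : ℝ)) ≠ 0 ∧
    fderiv ℝ (fderiv ℝ h) 0 ((1 : ℝ), (0 : ℝ)) ((0 : ℝ), (1 : ℝ)) ≠ 0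

/-- **Whitney cusp data depend only on the germ.** [folklore] -/
theorem HasWhitneyCuspData.congr_of_eventuallyEq {F₁ F₂ : 𝔼 4 → 𝔼 2} {y : 𝔼 4}
    (h : HasWhitneyCuspData F₁ y) (heq : F₁ =ᶠ[𝓝 y] F₂) : HasWhitneyCuspData F₂ y := by
  obtain ⟨φ, ψ, hh, U, ε₂, ε₃, hy, hy0, hmaps, hφ, hφs, hψ, hψs, hU, hhs, hφU, hε₂, hε₃, hid,
    hrest⟩ := h
  obtain ⟨S, hSsub, hSo, hyS⟩ : ∃ S ⊆ {q | F₁ q = F₂ q}, IsOpen S ∧ y ∈ S :=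
    _root_.mem_nhds_iff.1 heq
  have hsrc : (φ.restrOpen S hSo).source = φ.source ∩ S :=
    OpenPartialHomeomorph.restrOpen_source φ S hSo
  have htgt : (φ.restrOpen S hSo).target ⊆ φ.target := by
    intro z hz
    have h1 : (φ.restrOpen S hSo).symm z ∈ (φ.restrOpen S hSo).source :=
      (φ.restrOpen S hSo).map_target hz
    have h2 : (φ.restrOpen S hSo) ((φ.restrOpen S hSo).symm z) = z :=
      (φ.restrOpen S hSo).right_inv hz
    rw [hsrc] at h1
    have h3 : φ (φ.symm z) = z := h2
    rw [← h3]
    exact φ.map_source h1.1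
  refine ⟨φ.restrOpen S hSo, ψ, hh, U, ε₂, ε₃, ?_, hy0, ?_, ?_, hφs.mono htgt, hψ, hψs, hU, hhs,
    ?_, hε₂, hε₃, ?_, hrest⟩
  · rw [hsrc]
    exact ⟨hy, hyS⟩
  · intro q hq
    rw [hsrc] at hq
    rw [← show F₁ q = F₂ q from hSsub hq.2]
    exact hmaps hq.1
  · rw [hsrc]
    exact hφ.mono inter_subset_left
  · intro q hq
    rw [hsrc] at hq
    exact hφU q hq.1
  · intro q hq
    rw [hsrc] at hq
    rw [← show F₁ q = F₂ q from hSsub hq.2]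
    exact hid q hq.1

/-! ### The linear shear of the target -/

/-- The shear `(w₀, w₁) ↦ (w₀, w₁ - c w₀)` of `ℝ²`. [folklore] -/
def targetShear (c : ℝ) : 𝔼 2 ≃L[ℝ] 𝔼 2 :=
  ContinuousLinearEquiv.equivOfInverse
    (ContinuousLinearMap.id ℝ (𝔼 2) - c • (π₂ 0).smulRight (EuclideanSpace.single (1 : Fin 2) (1 : ℝ)))
    (ContinuousLinearMap.id ℝ (𝔼 2) + c • (π₂ 0).smulRight (EuclideanSpace.single (1 : Fin 2) (1 : ℝ)))
    (fun w => by ext i; fin_cases i <;> simp)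
    (fun w => by ext i; fin_cases i <;> simp)

/-- Components of the shear. [folklore] -/
@[simp]
theorem targetShear_apply_zero (c : ℝ) (w : 𝔼 2) : targetShear c w 0 = w 0 := by
  simp [targetShear]

/-- Components of the shear. [folklore] -/
@[simp]
theorem targetShear_apply_one (c : ℝ) (w : 𝔼 2) : targetShear c w 1 = w 1 - c * w 0 := by
  simp [targetShear]

/-! ### The synthesis -/

/-- `2 ≤ ∞` in `WithTop ℕ∞`. [folklore] -/
private theorem two_le_infty₆ : (2 : WithTop ℕ∞) ≤ ∞ := WithTop.coe_le_coe.2 le_top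

/-- **Whitney's data at a simple cusp of a generic map `ℝ⁴ → ℝ²`.**  Let `F` be `C^∞` with
`dF_p ≠ 0`, `p` a cusp candidate at which `j¹F ⋔ S₁` and `F` is cusp-generic.  Then `F` has
Whitney cusp data at `p`: centred smooth charts with `F = (t, h(t, x) + ε₂ y² + ε₃ z²)`,
`h(0) = ∂ₜh(0) = ∂ₓh(0) = ∂ₓ²h(0) = 0`, `∂ₓ³h(0) ≠ 0`, `∂ₜ∂ₓh(0) ≠ 0`.
[cite: GolubitskyGuillemin1973, Ch. VI §2, (2.1), Def. 2.3, proof of Thm. 2.4]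
[cite: BaykurSaeki2017, §2.1, p. 6] -/
theorem hasWhitneyCuspData_of_simpleCusp {F : 𝔼 4 → 𝔼 2} (hF : ContDiff ℝ ∞ F) {p : 𝔼 4}
    (hp : fderiv ℝ F p ≠ 0) (hcc : OneJet.IsCuspCandidateAt F p)
    (htr : OneJet.IsOneJetTransverseAt F p) (hcg : OneJet.IsCuspGenericAt F p) :
    HasWhitneyCuspData F p := by
  obtain ⟨φ, ψ, h, U, ε₂, ε₃, hpφ, hp0, hmaps, hφ, hφs, hψ, hψs, hU, hh, hφU, hh0, hε₂, hε₃, hid⟩ :=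
    hasCuspSplitChart_of_isCuspCandidateAt hF hp hcc htr
  have h0U : (0 : ℝ × ℝ) ∈ U := by
    have := hφU p hpφ
    rw [hp0] at this
    exact (by simpa using this : ((0 : ℝ), (0 : ℝ)) ∈ U)
  -- Step 1: the target shear killing `∂ₜh(0)`
  set c : ℝ := fderiv ℝ h 0 ((1 : ℝ), (0 : ℝ)) with hc
  set h' : ℝ × ℝ → ℝ := fun q => h q - c * q.1 with hh'_def
  have hh' : ContDiffOn ℝ ∞ h' U := hh.sub (contDiffOn_const.mul contDiffOn_fst)
  have hh'0 : h' 0 = 0 := by simp [hh'_def, hh0]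
  have hh'1 : fderiv ℝ h' 0 ((1 : ℝ), (0 : ℝ)) = 0 := by
    have hd : HasFDerivAt h (fderiv ℝ h 0) 0 :=
      ((hh.contDiffAt (hU.mem_nhds h0U)).differentiableAt (by simp)).hasFDerivAt
    have hd' : HasFDerivAt h' (fderiv ℝ h 0 - c • ContinuousLinearMap.fst ℝ ℝ ℝ) 0 :=
      hd.sub ((ContinuousLinearMap.fst ℝ ℝ ℝ).hasFDerivAt.const_mul c)
    rw [hd'.fderiv]
    simp [hc]
  set L : 𝔼 2 ≃L[ℝ] 𝔼 2 := targetShear c with hL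
  set ψ' : OpenPartialHomeomorph (𝔼 2) (𝔼 2) := ψ.trans L.toHomeomorph.toOpenPartialHomeomorph
    with hψ'
  have hψ'src : ψ'.source = ψ.source := by
    simp [hψ']
  have hψ'a : ∀ w, ψ' w = L (ψ w) := fun w => rfl
  have hψ's : ContDiffOn ℝ ∞ ψ' ψ'.source := by
    rw [hψ'src]
    exact L.contDiff.comp_contDiffOn hψ
  have hψ'ss : ContDiffOn ℝ ∞ ψ'.symm ψ'.target := by
    rw [hψ', OpenPartialHomeomorph.trans_symm_eq_symm_trans_symm, OpenPartialHomeomorph.trans_target,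
      OpenPartialHomeomorph.coe_trans]
    refine hψs.comp ?_ fun y hy => hy.2
    exact L.symm.contDiff.contDiffOn
  have hmaps' : MapsTo F φ.source ψ'.source := by
    rw [hψ'src]
    exact hmaps
  have hid' : ∀ q ∈ φ.source, ψ' (F q) 0 = φ q 0 ∧
      ψ' (F q) 1 = h' ((φ q) 0, (φ q) 1) + ε₂ * (φ q) 2 ^ 2 + ε₃ * (φ q) 3 ^ 2 := by
    intro q hq
    obtain ⟨h0q, h1q⟩ := hid q hq
    rw [hψ'a, hL, targetShear_apply_zero, targetShear_apply_one, h0q, h1q]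
    refine ⟨rfl, ?_⟩
    simp [hh'_def]
    ring
  -- Step 2: the split model of `h'` is the local representative
  have h0t : (0 : 𝔼 4) ∈ φ.target := hp0 ▸ φ.map_source hpφ
  have hrep : OneJet.rankOneMap (OneJet.cuspModelFn h' ε₂ ε₃) =ᶠ[𝓝 (0 : 𝔼 4)]
      (ψ' ∘ F ∘ φ.symm) := by
    filter_upwards [φ.open_target.mem_nhds h0t] with y hy
    have hq : φ.symm y ∈ φ.source := φ.map_target hy
    obtain ⟨h0', h1'⟩ := hid' (φ.symm y) hq
    rw [φ.right_inv hy] at h0' h1'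
    ext i
    fin_cases i
    · show OneJet.rankOneMap _ y 0 = ψ' (F (φ.symm y)) 0
      rw [OneJet.rankOneMap_apply_zero, h0']
    · show OneJet.rankOneMap _ y 1 = ψ' (F (φ.symm y)) 1
      rw [OneJet.rankOneMap_apply_one, h1']
      rfl
  -- Step 3: transport the three conditions to the model at `0`
  obtain ⟨A, -, hA⟩ := exists_fderiv_continuousLinearEquiv φ hφ hφs (by simp) hpφ
  rw [hp0] at hA
  have hpψ : F p ∈ ψ'.source := hmaps' hpφ
  obtain ⟨B, hB, -⟩ := exists_fderiv_continuousLinearEquiv ψ' hψ's hψ'ss (by simp) hpψ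
  have hφs2 : ContDiffAt ℝ 2 φ.symm 0 :=
    (hφs.contDiffAt (φ.open_target.mem_nhds h0t)).of_le two_le_infty₆
  have hψ2 : ContDiffAt ℝ 2 ψ' (F p) :=
    (hψ's.contDiffAt (ψ'.open_source.mem_nhds hpψ)).of_le two_le_infty₆
  have hF2 : ContDiffAt ℝ 2 F p := hF.contDiffAt.of_le two_le_infty₆
  have hp' : φ.symm 0 = p := by rw [← hp0, φ.left_inv hpφ]
  have hψF2 : ContDiffAt ℝ 2 (ψ' ∘ F) (φ.symm 0) := by
    rw [hp']
    exact hψ2.comp p hF2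
  have hcc' : OneJet.IsCuspCandidateAt (OneJet.rankOneMap (OneJet.cuspModelFn h' ε₂ ε₃)) 0 := by
    rw [OneJet.isCuspCandidateAt_congr_of_eventuallyEq hrep,
      show ψ' ∘ F ∘ φ.symm = (ψ' ∘ F) ∘ φ.symm from rfl,
      OneJet.isCuspCandidateAt_comp_iff A.symm hA hφs2 hψF2, hp',
      OneJet.isCuspCandidateAt_comp_target_iff B hB hψ2 hF2]
    exact hcc
  have htr' : OneJet.IsOneJetTransverseAt (OneJet.rankOneMap (OneJet.cuspModelFn h' ε₂ ε₃)) 0 := by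
    rw [OneJet.isOneJetTransverseAt_congr_of_eventuallyEq hrep,
      show ψ' ∘ F ∘ φ.symm = (ψ' ∘ F) ∘ φ.symm from rfl,
      OneJet.isOneJetTransverseAt_comp_iff A.symm hA hφs2 hψF2, hp',
      OneJet.isOneJetTransverseAt_comp_target_iff B hB hψ2 hF2]
    exact htr
  have hcg' : OneJet.IsCuspGenericAt (OneJet.rankOneMap (OneJet.cuspModelFn h' ε₂ ε₃)) 0 := by
    rw [OneJet.isCuspGenericAt_congr_of_eventuallyEq hrep,
      show ψ' ∘ F ∘ φ.symm = (ψ' ∘ F) ∘ φ.symm from rfl]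
    -- `ψ' ∘ F` is cusp-generic at `p`, then `(ψ' ∘ F) ∘ φ⁻¹` at `0`
    set Ω : Set (𝔼 4) := F ⁻¹' ψ'.source with hΩ
    have hΩo : IsOpen Ω := ψ'.open_source.preimage hF.continuous
    have hpΩ : p ∈ Ω := hpψ
    have hFΩ : ContDiffOn ℝ ∞ F Ω := hF.contDiffOn
    have h1 : OneJet.IsCuspGenericAt (ψ' ∘ F) p :=
      hcg.comp_target hΩo hFΩ hpΩ ψ'.open_source hψ's (fun q hq => hq) hB
    have hψF : ContDiffOn ℝ ∞ (ψ' ∘ F) Ω := hψ's.comp hFΩ fun q hq => hq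
    have h2 := OneJet.IsCuspGenericAt.comp_source (g := ψ' ∘ F) hΩo hψF φ.open_target hφs
      (fun y hy => show F (φ.symm y) ∈ ψ'.source from hmaps' (φ.map_target hy)) h0t hA
      (by rw [hp']; exact h1)
    exact h2
  -- Step 4: Whitney's conditions for `h'`
  have hε₂0 : ε₂ ≠ 0 := by rintro rfl; norm_num at hε₂
  have hε₃0 : ε₃ ≠ 0 := by rintro rfl; norm_num at hε₃
  obtain ⟨w1, w2, w3, w4⟩ :=
    OneJet.whitney_conditions_of_cuspModel hU h0U hh' hε₂0 hε₃0 hcc' htr' hcg'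
  exact ⟨φ, ψ', h', U, ε₂, ε₃, hpφ, hp0, hmaps', hφ, hφs, hψ's, hψ'ss, hU, hh', hφU, hε₂, hε₃,
    hid', hh'0, hh'1, w1, w2, w4, w3⟩

/-- **Generic maps of a closed 4-manifold have Whitney cusp data at every cusp candidate**
(synthesis with `TwoGenericMapsExist.exists_twoGeneric_map`): there is a `C^∞` map
`f : M → ℝ²` such that at every point `q` whose chart representative has a cusp candidate at
`φ_q q`, that representative has Whitney cusp data there — so Whitney's planar theorem
(GG VI Thm. 2.4) gives the cusp chart `(t, x³ + tx ± y² ± z²)`.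
[cite: BaykurSaeki2017, §2.1, p. 6] [cite: GolubitskyGuillemin1973, Ch. VI §2, Thm. 2.4] -/
theorem exists_map_whitneyCuspData (M : Type*) [TopologicalSpace M] [T2Space M] [CompactSpace M]
    [ChartedSpace (𝔼 4) M] [IsManifold (modelWithCornersSelf ℝ (𝔼 4)) ∞ M] :
    ∃ f : M → 𝔼 2, ContMDiff (modelWithCornersSelf ℝ (𝔼 4)) (modelWithCornersSelf ℝ (𝔼 2)) ∞ f ∧
      ∀ q : M, ∀ G : 𝔼 4 → 𝔼 2, ContDiff ℝ ∞ G →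
        G =ᶠ[𝓝 (extChartAt (modelWithCornersSelf ℝ (𝔼 4)) q q)]
          (f ∘ (extChartAt (modelWithCornersSelf ℝ (𝔼 4)) q).symm) →
        OneJet.IsCuspCandidateAt G (extChartAt (modelWithCornersSelf ℝ (𝔼 4)) q q) →
          HasWhitneyCuspData G (extChartAt (modelWithCornersSelf ℝ (𝔼 4)) q q) := by
  obtain ⟨f, hf, hgen⟩ := OneJet.exists_twoGeneric_map M
  refine ⟨f, hf, fun q G hG heq hccG => ?_⟩
  obtain ⟨hne, htr, hcg⟩ := hgen q
  refine hasWhitneyCuspData_of_simpleCusp hG ?_ hccG ?_ ?_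
  · rwa [heq.fderiv_eq]
  · exact (OneJet.isOneJetTransverseAt_congr_of_eventuallyEq heq).2 htr
  · exact (OneJet.isCuspGenericAt_congr_of_eventuallyEq heq).2 hcg

end Literature.Topology.FourManifolds
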